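import Mathlib
import Summits.NavierStokesRegularity.NavierStokesRegularity.Theorems.TaoLadderRungTwoFlatCertificateGlueJacobianVarMatOn
import HarnessLib

/-!
# The one-shift window system, XXVI: SPARSE QUADRATIC FIELDS IN DYADIC INTERVAL ARITHMETIC — the executable field
# twin `sqEvalA` and the executable sparse Jacobian `sqJacA` of a field given row by row as a list of products
# `q · u_a · w_b`, with their soundness in the formats `IsFieldEnclosureA` (⇒ `jetLevelsA` encloses the Taylor jets)
# and `IsJacEnclosureA` (⇒ `varMatLevelsA` encloses the variational jets of all directions) (cell harvest/h2-tao-ladder,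
# seat p2; rung1/KERNEL-CHEAP-REPLAY-SPEC.md §2 (a)/(b)/(e), §7 «CHECKER»; support for K1(1) = `NoSurvivingDSSOne`,
# stmt-NavierStokesRegularity-20205)

MODEL lattice ODEs only (Tao 2016 §4 normal form on Tao's shift set `S`); nothing here is a statement about
the Navier–Stokes equations; no item is closed; nothing numerical is certified. This is the FIRST computational
layer of the one-shift certificate's checker: the centre field of a step is a term-list field (part XVIII; part XIX
`termField_wterms`), whose homogenisation (part XXII `lift`: one extra coordinate frozen at `1`) is a SPARSE
HOMOGENEOUS QUADRATIC field on `Fin N → ℝ`, `Q u w c = Σ_{(q,a,b) ∈ row c} q · u_a · w_b`. For such a field this file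
gives

* the data format `SQRows = Array (List (IntervalD × ℕ × ℕ))` (row `c`: coefficient box, first index, second index)
  and the real-side relation `IsSQEnclosure Q SD` (each row of `SD` is matched by a decorated row whose coefficients
  lie in their boxes and whose bilinear functional IS row `c` of `Q`);
* `sqEvalA N prec SD A B` — the rounded interval evaluation of `Q` on two box vectors, and
  **`isFieldEnclosureA_sqEvalA`**: it is an interval extension of `Q` in the sense of
  `TaylorModelCert.IntervalD.IsFieldEnclosureA` — so `TaylorModelCert.IntervalD.mem_jet_of_jetLevelsA` applies: the
  array-materialised interval jets `jetLevelsA N (sqEvalA N prec SD) prec Y K` enclose `taylorJet Q y k` for every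
  `y` in the box `Y` (`mem_taylorJet_of_jetLevelsA_sq`);
* `sqJacA N prec SD A` — the sparse interval Jacobian rows `v ↦ (Q x v + Q v x)_c` at a state box (entries
  `(b, q·A[a])`, `(a, q·A[b])` per product), and **`isJacEnclosureA_sqJacA`**: it is a sparse interval Jacobian in
  the sense of `CertificateGlueOn.IsJacEnclosureA` — so `CertificateGlueOn.mem_varMatLevelsA` applies: the
  all-directions variational table encloses `varJet Q y v_j k` (`mem_varJet_of_varMatLevelsA_sq`).

Everything executable computes on `ℤ` (dyadic mantissas/exponents), so closed instances evaluate by `native_decide`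
(referee P162: computational) or `decide`.
-/

-- the sub-problem namespace repeats the summit name by design (D-0017)
set_option linter.dupNamespace false

namespace Summit.NavierStokesRegularity.NavierStokesRegularity.Theorems

namespace DSSOneShift

open Summit.NavierStokesRegularity.NavierStokesRegularity.Theorems.TaylorModelCert
open Summit.NavierStokesRegularity.NavierStokesRegularity.Theorems.TaylorModelReadout
open Summit.NavierStokesRegularity.NavierStokesRegularity.Theorems.CertificateGlueOn

/-! ### The data format and the executable side -/

/-- Sparse quadratic rows: row `c` is a list of products `(coefficient box, first index, second index)`.
[cite: Moore1979, §3.2 (natural interval extension); cell vocabulary, harvest/h2-tao-ladder rung1/KERNEL-CHEAP-REPLAY-SPEC.md §1 (term list)] -/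
abbrev SQRows : Type := Array (List (IntervalD × ℕ × ℕ))

/-- Row `c` of a sparse quadratic table (junk `[]` beyond the size). [folklore] -/
def sqRow (SD : SQRows) (c : ℕ) : List (IntervalD × ℕ × ℕ) := if h : c < SD.size then SD[c] else []

/-- `sqRow` of `Array.ofFn`. [folklore] -/
theorem sqRow_ofFn {N : ℕ} (f : Fin N → List (IntervalD × ℕ × ℕ)) {c : ℕ} (hc : c < N) :
    sqRow (Array.ofFn f) c = f ⟨c, hc⟩ := by
  unfold sqRow
  rw [dif_pos (by rw [Array.size_ofFn]; exact hc), Array.getElem_ofFn]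

/-- The rounded interval value `Σ_{(q,a,b)} q ⊗ A[a] ⊗ B[b]` of one sparse row on two box vectors. [cite: Moore1979, §3.2 (natural interval extension)] -/
def sqRowEval (prec : ℕ) (A B : Array IntervalD) : List (IntervalD × ℕ × ℕ) → IntervalD
  | [] => IntervalD.ofInt 0
  | t :: l => IntervalD.addR prec
      (IntervalD.mulR prec (IntervalD.mulR prec t.1 (IntervalD.aget A t.2.1)) (IntervalD.aget B t.2.2))
      (sqRowEval prec A B l)

/-- **The interval twin of a sparse quadratic field** on arrays of size `N`. [cite: Moore1979, §3.2 (natural interval extension)] -/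
def sqEvalA (N prec : ℕ) (SD : SQRows) (A B : Array IntervalD) : Array IntervalD :=
  Array.ofFn fun c : Fin N => sqRowEval prec A B (sqRow SD c)

/-- The sparse Jacobian entries of one row at the state box `A`: the product `q · u_a · w_b` contributes
`(b, q ⊗ A[a])` (slot of the second argument) and `(a, q ⊗ A[b])` (slot of the first). [folklore] -/
def sqRowJac (prec : ℕ) (A : Array IntervalD) : List (IntervalD × ℕ × ℕ) → List (ℕ × IntervalD)
  | [] => []
  | t :: l => (t.2.2, IntervalD.mulR prec t.1 (IntervalD.aget A t.2.1)) ::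
      (t.2.1, IntervalD.mulR prec t.1 (IntervalD.aget A t.2.2)) :: sqRowJac prec A l

/-- **The sparse interval Jacobian of a sparse quadratic field** at the state box `A` (rows `c < N`). [folklore] -/
def sqJacA (N prec : ℕ) (SD : SQRows) (A : Array IntervalD) : Array (List (ℕ × IntervalD)) :=
  Array.ofFn fun c : Fin N => sqRowJac prec A (sqRow SD c)

/-- The twin's outputs have size `N`. [folklore] -/
theorem size_sqEvalA (N prec : ℕ) (SD : SQRows) (A B : Array IntervalD) : (sqEvalA N prec SD A B).size = N := by
  simp only [sqEvalA, Array.size_ofFn]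

/-! ### The real side: decorated rows -/

/-- The bilinear functional `Σ_{(q,a,b)} q · u a · w b` of a decorated sparse row. [folklore] -/
noncomputable def sqRowVal (σ : List (ℝ × ℕ × ℕ)) (u w : ℕ → ℝ) : ℝ := (σ.map fun t => t.1 * u t.2.1 * w t.2.2).sum

/-- `sqRowVal` of a cons. [folklore] -/
@[simp] theorem sqRowVal_cons (t : ℝ × ℕ × ℕ) (σ : List (ℝ × ℕ × ℕ)) (u w : ℕ → ℝ) :
    sqRowVal (t :: σ) u w = t.1 * u t.2.1 * w t.2.2 + sqRowVal σ u w := by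
  simp [sqRowVal]

/-- `sqRowVal` of the empty row. [folklore] -/
@[simp] theorem sqRowVal_nil (u w : ℕ → ℝ) : sqRowVal [] u w = 0 := by simp [sqRowVal]

/-- A decorated row MATCHES an interval row: same indices (all `< N`), each real coefficient in its box. [folklore] -/
def SQRowOK (N : ℕ) (σ : List (ℝ × ℕ × ℕ)) (row : List (IntervalD × ℕ × ℕ)) : Prop :=
  List.Forall₂ (fun s t => IntervalD.mem s.1 t.1 ∧ s.2 = t.2 ∧ s.2.1 < N ∧ s.2.2 < N) σ row

/-- **`SD` is a sparse interval presentation of the quadratic field `Q`**: every row `c` of `SD` is matched by a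
decorated row whose bilinear functional is `(u, w) ↦ Q u w c`. [cite: Moore1979, §3.2 (natural interval extension); cell vocabulary, harvest/h2-tao-ladder rung1/KERNEL-CHEAP-REPLAY-SPEC.md §1] -/
def IsSQEnclosure {N : ℕ} (Q : (Fin N → ℝ) → (Fin N → ℝ) → Fin N → ℝ) (SD : SQRows) : Prop :=
  ∀ c : Fin N, ∃ σ : List (ℝ × ℕ × ℕ), SQRowOK N σ (sqRow SD c) ∧ ∀ u w, Q u w c = sqRowVal σ (rdN u) (rdN w)

/-! ### Soundness of the field twin -/

/-- One row: the real value lies in the rounded interval value. [cite: Moore1979, §3.2 (inclusion property under outward rounding)] -/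
theorem mem_sqRowEval (prec : ℕ) {N : ℕ} {A B : Array IntervalD} {u w : ℕ → ℝ}
    (hu : ∀ a < N, IntervalD.mem (u a) (IntervalD.aget A a)) (hw : ∀ b < N, IntervalD.mem (w b) (IntervalD.aget B b)) :
    ∀ {σ : List (ℝ × ℕ × ℕ)} {row : List (IntervalD × ℕ × ℕ)}, SQRowOK N σ row →
      IntervalD.mem (sqRowVal σ u w) (sqRowEval prec A B row)
  | _, _, List.Forall₂.nil => by simpa [sqRowEval] using IntervalD.mem_ofInt 0
  | _, _, List.Forall₂.cons (a := s) (b := t) h hl => by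
    obtain ⟨hq, hidx, ha, hb⟩ := h
    rw [sqRowVal_cons, sqRowEval]
    refine IntervalD.mem_addR prec ?_ (mem_sqRowEval prec hu hw hl)
    rw [← hidx]
    exact IntervalD.mem_mulR prec (IntervalD.mem_mulR prec hq (hu _ ha)) (hw _ hb)

/-- **THE FIELD TWIN IS AN INTERVAL EXTENSION** (`IsFieldEnclosureA` for the reader `rdN`). [cite: Moore1979, §3.2 (natural interval extension, inclusion property)] -/
theorem isFieldEnclosureA_sqEvalA {N : ℕ} {Q : (Fin N → ℝ) → (Fin N → ℝ) → Fin N → ℝ} {SD : SQRows}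
    (hSD : IsSQEnclosure Q SD) (prec : ℕ) : IntervalD.IsFieldEnclosureA rdN Q N (sqEvalA N prec SD) := by
  intro A B u w _ _ hu hw c hc
  obtain ⟨σ, hσ, hQ⟩ := hSD ⟨c, hc⟩
  rw [rdN_of_lt _ hc, hQ u w]
  unfold sqEvalA
  rw [IntervalD.aget_ofFn _ hc]
  exact mem_sqRowEval prec hu hw hσ

/-- **The array-materialised interval jets of a sparse quadratic field enclose its Taylor jets**: for `y` with
coordinates in the box `Y` (size `N`), `taylorJet Q y k c ∈ (jetLevelsA N (sqEvalA N prec SD) prec Y K)[k][c]` for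
`k ≤ K`, `c < N`. [cite: Moore1979, §3.4 eqs. (3.13)–(3.17); cell vocabulary, harvest/h2-tao-ladder rung1/KERNEL-CHEAP-REPLAY-SPEC.md §2 (a)/(b)] -/
theorem mem_taylorJet_of_jetLevelsA_sq {N : ℕ} {Q : (Fin N → ℝ) → (Fin N → ℝ) → Fin N → ℝ} {SD : SQRows}
    (hSD : IsSQEnclosure Q SD) (prec K : ℕ) {Y : Array IntervalD} (hY : Y.size = N) {y : Fin N → ℝ}
    (hy : ∀ c < N, IntervalD.mem (rdN y c) (IntervalD.aget Y c)) :
    ∀ k ≤ K, ∀ c < N, IntervalD.mem (rdN (taylorJet Q y k) c)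
      (IntervalD.aget (IntervalD.lget (IntervalD.jetLevelsA N (sqEvalA N prec SD) prec Y K) k) c) :=
  IntervalD.mem_jet_of_jetLevelsA (rd := rdN) (Q := Q) (T := taylorJet Q) (fun x c hc => by rw [taylorJet_zero])
    (fun x k c hc => by rw [rdN_of_lt _ hc, taylorJet_succ_apply, Finset.sum_congr rfl fun i _ => (rdN_of_lt _ hc)])
    (isFieldEnclosureA_sqEvalA hSD prec) prec K hY hy

/-! ### Soundness of the Jacobian twin -/

/-- The decorated Jacobian row of a decorated coefficient row at the state `x`. [folklore] -/
noncomputable def sqRowJacDec (prec : ℕ) (A : Array IntervalD) (x : ℕ → ℝ) :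
    List (ℝ × ℕ × ℕ) → List (IntervalD × ℕ × ℕ) → List (ℕ × ℝ × IntervalD)
  | s :: σ, t :: row => (t.2.2, s.1 * x s.2.1, IntervalD.mulR prec t.1 (IntervalD.aget A t.2.1)) ::
      (t.2.1, s.1 * x s.2.2, IntervalD.mulR prec t.1 (IntervalD.aget A t.2.2)) :: sqRowJacDec prec A x σ row
  | _, _ => []

/-- The decorated Jacobian row is sound, projects to `sqRowJac`, has indices `< N`, and its functional is
`v ↦ Σ (q x_a v_b + q v_a x_b)`. [folklore] -/
theorem sqRowJacDec_spec (prec : ℕ) {N : ℕ} {A : Array IntervalD} {x : ℕ → ℝ}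
    (hx : ∀ a < N, IntervalD.mem (x a) (IntervalD.aget A a)) :
    ∀ {σ : List (ℝ × ℕ × ℕ)} {row : List (IntervalD × ℕ × ℕ)}, SQRowOK N σ row →
      OkRow (sqRowJacDec prec A x σ row) ∧ projRow (sqRowJacDec prec A x σ row) = sqRowJac prec A row ∧
        (∀ t ∈ sqRowJacDec prec A x σ row, t.1 < N) ∧
        ∀ v : ℕ → ℝ, sqRowVal σ x v + sqRowVal σ v x = valRow (sqRowJacDec prec A x σ row) v
  | _, _, List.Forall₂.nil => by
    refine ⟨fun t ht => by simp [sqRowJacDec] at ht, rfl, fun t ht => by simp [sqRowJacDec] at ht, fun v => ?_⟩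
    simp [sqRowJacDec, valRow]
  | _, _, List.Forall₂.cons (a := s) (b := t) h hl => by
    obtain ⟨hq, hidx, ha, hb⟩ := h
    obtain ⟨hok, hproj, hbd, hval⟩ := sqRowJacDec_spec prec hx hl
    have ea : t.2.1 = s.2.1 := by rw [← hidx]
    have eb : t.2.2 = s.2.2 := by rw [← hidx]
    refine ⟨?_, ?_, ?_, fun v => ?_⟩
    · intro r hr
      simp only [sqRowJacDec, List.mem_cons] at hr
      rcases hr with rfl | rfl | hr
      · exact IntervalD.mem_mulR prec hq (by rw [ea]; exact hx _ ha)
      · exact IntervalD.mem_mulR prec hq (by rw [eb]; exact hx _ hb)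
      · exact hok r hr
    · simp only [sqRowJacDec, projRow_cons, sqRowJac, hproj]
    · intro r hr
      simp only [sqRowJacDec, List.mem_cons] at hr
      rcases hr with rfl | rfl | hr
      · exact eb ▸ hb
      · exact ea ▸ ha
      · exact hbd r hr
    · simp only [sqRowJacDec, sqRowVal_cons, valRow_cons]
      rw [← hval v, ea, eb]
      ring

/-- **THE JACOBIAN TWIN IS A SPARSE INTERVAL JACOBIAN** (`IsJacEnclosureA`). [cite: Zgliczynski2002C1Lohner, §3 (variational equation alongside the flow); Moore1979, §3.2] -/
theorem isJacEnclosureA_sqJacA {N : ℕ} {Q : (Fin N → ℝ) → (Fin N → ℝ) → Fin N → ℝ} {SD : SQRows}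
    (hSD : IsSQEnclosure Q SD) (prec : ℕ) : IsJacEnclosureA Q (sqJacA N prec SD) := by
  intro A x hx c
  obtain ⟨σ, hσ, hQ⟩ := hSD c
  obtain ⟨hok, hproj, hbd, hval⟩ := sqRowJacDec_spec prec (x := rdN x) hx hσ
  refine ⟨sqRowJacDec prec A (rdN x) σ (sqRow SD c), hok, ?_, hbd, fun v => ?_⟩
  · unfold sqJacA
    rw [rget_ofFn _ c.isLt, hproj]
  · rw [hQ x v, hQ v x, hval]

/-- **The all-directions variational table of a sparse quadratic field encloses its variational jets**: with state
levels `Ls` enclosing `taylorJet Q y i` (`i ≤ K`; e.g. `jetLevelsA`) and an initial matrix `D` enclosing the directions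
`vs j` column-major, `varJet Q y (vs j) k c ∈ V_k[c][j]`. [cite: Zgliczynski2002C1Lohner, §3–4 (the variational part, propagated as a matrix); WalawskaWilczak2016, §1.1] -/
theorem mem_varJet_of_varMatLevelsA_sq {N : ℕ} {Q : (Fin N → ℝ) → (Fin N → ℝ) → Fin N → ℝ} {SD : SQRows}
    (hSD : IsSQEnclosure Q SD) (prec K : ℕ) {Ls : Array (Array IntervalD)} {y : Fin N → ℝ}
    (hT : ∀ i ≤ K, ∀ c < N, IntervalD.mem (rdN (taylorJet Q y i) c) (IntervalD.aget (IntervalD.lget Ls i) c))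
    {D : Array IntervalD} {vs : ℕ → Fin N → ℝ}
    (hv : ∀ j < N, ∀ c < N, IntervalD.mem (rdN (vs j) c) (IntervalD.aget D (j * N + c))) :
    ∀ k ≤ K, ∀ j < N, ∀ c < N, IntervalD.mem (rdN (varJet Q y (vs j) k) c)
      (IntervalD.aget (IntervalD.lget (varMatLevelsA N prec (jacLevelsA (sqJacA N prec SD) Ls K) D K) k) (j * N + c)) :=
  mem_varMatLevelsA (isJacEnclosureA_sqJacA hSD prec) prec K hT hv

end DSSOneShift

end Summit.NavierStokesRegularity.NavierStokesRegularity.Theorems
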